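import Summits.Ventures.PercRepro.MSTightConjTAlpha

/-!
# Conjecture (T): two reductions through the realisation lemmas, and the candidate Prop

Dossier proofs/MINE1-theoremS.md, Addendum 45. Setting: `r` an element, `P = proj r F` tight,
`R_P = Rstar P`; `F₀ = part0 r F`, `F₁ = partr r F`, `K = partner r F`, `P₀ = F₀ ∖ K`,
`P₁ = F₁ ∖ K`; `X = diffsX r F`, `Y = diffsY r F`.

* **The canonical realisation.** Every difference `z` of the tight trace is `a ∖ b` with
  `a = p ∪ R_P ⊇ R_P` (top row) and `b = p ∩ R_P ⊆ R_P` (bottom row), where `p ∈ P` is the flip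
  preimage `z = p ∆ R_P` (`exists_top_bottom_realisation`). Hence the census statement (TB) —
  «no partnerless `r`-member contains `R_P`, or no partnerless `r`-free member lies inside `R_P`» —
  implies `Y ⊆ X` (`diffsY_subset_diffsX_of_top_bottom`). No twin-freeness is needed.
* **The dichotomy reduction.** If every partnerless `r`-member lies below a partner member, or
  every partnerless `r`-free member lies above one, then `Y ⊆ X`
  (`diffsY_subset_diffsX_of_dichotomy`; the realisation lemmas of MSTightConjTAlpha, twin-free
  trace). On the census this dichotomy holds in every case-(β) configuration
  (`|K ∖∖ K| = |K| + 1`), where case (α) is already a theorem.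
* The general form of Conjecture (T) is the candidate Prop `ConjT α` of MSTightConjTCandidate.lean.
-/

namespace PercRepro.MSTight

open Finset
open scoped FinsetFamily symmDiff

variable {α : Type*} [DecidableEq α] [Fintype α] {r : α} {F : Finset (Finset α)}

section TopBottom

variable (hP : Tight (proj r F))
include hP

/-- **The canonical realisation of a difference of a tight family:** `z = a ∖ b` with
`a = p ∪ R ∈ P`, `b = p ∩ R ∈ P`, `R ⊆ a`, `b ⊆ R`, where `R = Rstar P`. -/
theorem exists_top_bottom_realisation {z : Finset α} (hz : z ∈ proj r F \\ proj r F) :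
    ∃ a ∈ proj r F, ∃ b ∈ proj r F, Rstar (proj r F) ⊆ a ∧ b ⊆ Rstar (proj r F) ∧ a \ b = z := by
  set R := Rstar (proj r F) with hR
  have hempty : (∅ : Finset α) ∈ proj r F \\ proj r F := by
    obtain ⟨A, hA, _⟩ := mem_diffs.1 hz
    exact mem_diffs.2 ⟨A, hA, A, hA, Finset.sdiff_self A⟩
  rw [diffs_eq_flip_of_tight hP] at hz
  obtain ⟨p, hp, rfl⟩ := mem_flip.1 hz
  obtain ⟨hp1, hp2⟩ := (mem_iff_parts hP).1 hp
  refine ⟨p ∪ R, ?_, p ∩ R, ?_, subset_union_right, inter_subset_right, ?_⟩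
  · rw [mem_iff_parts hP]
    refine ⟨?_, ?_⟩
    · rw [union_sdiff_right]; exact hp1
    · rw [sdiff_eq_empty_iff_subset.2 subset_union_right]; exact hempty
  · rw [mem_iff_parts hP]
    refine ⟨?_, ?_⟩
    · rw [sdiff_eq_empty_iff_subset.2 inter_subset_right]; exact hempty
    · rw [sdiff_inter_self_right]; exact hp2
  · ext x
    simp only [mem_sdiff, mem_union, mem_inter, mem_symmDiff]
    tauto

/-- **(TB) ⟹ (T).** If no partnerless `r`-member contains `R_P`, or no partnerless `r`-free member
lies inside `R_P`, then every type-I difference is an `r`-free difference. -/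
theorem diffsY_subset_diffsX_of_top_bottom
    (hTB : (∀ a ∈ partr r F, Rstar (proj r F) ⊆ a → a ∈ part0 r F) ∨
      (∀ b ∈ part0 r F, b ⊆ Rstar (proj r F) → b ∈ partr r F)) :
    diffsY r F ⊆ diffsX r F := by
  intro z hz
  have hzD : z ∈ proj r F \\ proj r F := diffsY_subset_diffs_proj' hz
  obtain ⟨a, ha, b, hb, hRa, hbR, rfl⟩ := exists_top_bottom_realisation hP hzD
  rw [proj_eq_union, mem_union] at ha hb
  -- `a ∈ F₀` or `b ∈ F₁` puts `a ∖ b` into `X`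
  have key : a ∈ part0 r F ∨ b ∈ partr r F → a \ b ∈ diffsX r F := by
    rintro (ha0 | hb1)
    · rcases hb with hb0 | hb1
      · exact mem_union.2 (Or.inl (mem_union.2 (Or.inl (mem_diffs.2 ⟨a, ha0, b, hb0, rfl⟩))))
      · exact mem_union.2 (Or.inr (mem_diffs.2 ⟨a, ha0, b, hb1, rfl⟩))
    · rcases ha with ha0 | ha1
      · exact mem_union.2 (Or.inr (mem_diffs.2 ⟨a, ha0, b, hb1, rfl⟩))
      · exact mem_union.2 (Or.inl (mem_union.2 (Or.inr (mem_diffs.2 ⟨a, ha1, b, hb1, rfl⟩))))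
  apply key
  rcases hTB with hT | hB
  · rcases ha with ha0 | ha1
    · exact Or.inl ha0
    · exact Or.inl (hT a ha1 hRa)
  · rcases hb with hb0 | hb1
    · exact Or.inr (hB b hb0 hbR)
    · exact Or.inr hb1

end TopBottom

section Dichotomy

variable (hP : Tight (proj r F)) (htf : ∀ a b, Twin (proj r F) a b → a = b)
include hP htf

/-- **The dichotomy ⟹ (T).** If every partnerless `r`-member lies below a partner member, or every
partnerless `r`-free member lies above a partner member, then `Y ⊆ X`. -/
theorem diffsY_subset_diffsX_of_dichotomy
    (hdich : (∀ t ∈ partr r F, t ∉ part0 r F → ∃ k ∈ partner r F, t ⊆ k) ∨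
      (∀ s ∈ part0 r F, s ∉ partr r F → ∃ k ∈ partner r F, k ⊆ s)) :
    diffsY r F ⊆ diffsX r F := by
  intro z hz
  obtain ⟨t, ht, s, hs, rfl⟩ := mem_diffs.1 hz
  rcases hdich with hT | hS
  · by_cases ht0 : t ∈ part0 r F
    · exact mem_union.2 (Or.inl (mem_union.2 (Or.inl (mem_diffs.2 ⟨t, ht0, s, hs, rfl⟩))))
    · obtain ⟨k, hk, htk⟩ := hT t ht ht0
      exact sdiff_mem_diffsX_of_superset_mem_part0 hP htf hz (mem_inter.1 hk).1
        (sdiff_subset.trans htk)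
  · by_cases hs1 : s ∈ partr r F
    · exact mem_union.2 (Or.inl (mem_union.2 (Or.inr (mem_diffs.2 ⟨t, ht, s, hs1, rfl⟩))))
    · obtain ⟨k, hk, hks⟩ := hS s hs hs1
      refine sdiff_mem_diffsX_of_disjoint_mem_partr hP htf hz (mem_inter.1 hk).2 ?_
      rw [Finset.disjoint_left]
      intro x hx hxk
      exact (mem_sdiff.1 hx).2 (hks hxk)

end Dichotomy

end PercRepro.MSTight
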